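import Summits.AnomalousDissipation.AnomalousDissipation.Theorems.BaireTransferRobustLoudUpgradeCategoryGeneric
import Summits.AnomalousDissipation.AnomalousDissipation.Theorems.BaireTransferRobustLoudUpgradeStubSplitGlue

/-!
# Typed decomposition of the wild residual of the crux `BaireTransfer.RobustLoudUpgrade` (stmt-AnomalousDissipation-1144)
# by witness type, with the generic mean-zero steady piece removed

Lead c15 of the line `malkin-cone-group-orbits` (category package, cycle 2).  The loud set of the crux splits by the type of its
witnesses (`loud_subset_union`, `loud_eq_union`):

  `loud S a E ε = loudSteadyLeaf S a E ε ∪ loudSteadyDrift S a E ε ∪ loudCycle S a E ε`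

— mean-zero classical steady states (`…Category.loudSteadyLeaf`), classical steady states of NON-ZERO mean (drift states,
`loudSteadyDrift`), and classical time-periodic solutions that are NOT constant in time (`loudCycle`).  By the generic persistence
theorem (`…CategoryGeneric.loudSteadyLeaf_inter_genericSet_subset`) the first piece contributes to the crux's wild residual
`loud(E,ε) ∖ closure (interior loud(2E,ε/2))` only through the MEAGRE, budget-free exceptional set `(genericSet S)ᶜ`:

  `residual_decomposition`:  `loud S a E ε ∖ closure (interior (loud S a (2E) (ε/2))) ⊆
      (loudSteadyLeaf S a E ε ∩ (genericSet S)ᶜ) ∪ (loudSteadyDrift S a E ε ∖ cl int LOUD₂) ∪ (loudCycle S a E ε ∖ cl int LOUD₂)`  (`0 < ε`).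

So a counterexample to the crux is carried by (i) a non-generic force with only mean-zero steady loud witnesses, or (ii) a drift
steady witness, or (iii) a genuine cycle — the registered sub-goal `residual_decomposition_registered` states this with the two new
classes written out.  (The category of pieces (ii)–(iii) is open: it needs the drifted steady weak theory, resp. a parabolic
compactness theorem for `H¹`-bounded periodic classical solutions, neither in the tree.)

References: the route file `Theses/BaireTransfer.lean` (items 1143–1145); `Cruxes/RobustLoudUpgrade/STRATEGY-CENSUS.md` (D2, W1);
`Theorems/BaireTransferRobustLoudUpgradeStubSplitGlue.lean` (census D2 glue).
-/

-- `Summit.<Summit>.<Problem>` is the tree's mandated summit-side namespace (CONVENTIONS §2); for this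
-- single-conjunct summit the two coincide, so the duplicate is deliberate.
set_option linter.dupNamespace false

noncomputable section

open scoped Topology
open Filter Set Function TopologicalSpace MeasureTheory

namespace Summit.AnomalousDissipation.AnomalousDissipation.Theorems.RobustLoudUpgrade.Category

open Literature.Analysis.FunctionSpaces Literature.Analysis.FunctionSpaces.Torus
open Literature.Analysis.FluidPDE
open Summit.AnomalousDissipation.AnomalousDissipation.Theses.BaireTransfer

/-- The flat unit torus `T³`. -/
local notation "𝕋³" => UnitAddTorus (Fin 3)
/-- Real velocity values. -/
local notation "ℝ³" => EuclideanSpace ℝ (Fin 3)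

/-! ## §1 The two remaining witness classes -/

/-- **Drift steady witnesses**: `c` carries, at some `ν ∈ (0,a)`, a classical steady state of NON-ZERO mean with budgets `(E, ε)`
(the Galilean-drift states of `Theorems/RobustLoudUpgrade/Negative/GalileanDrift*`). [folklore] -/
def loudSteadyDrift (S : Finset (Fin 3 → ℤ)) (a E ε : ℝ) : Set (Coeff S) :=
  {c | ∃ ν : ℝ, 0 < ν ∧ ν < a ∧ ∃ (u : 𝕋³ → ℝ³) (p : 𝕋³ → ℝ),
    Torus.IsSteadyNSState ν (force S c) u p ∧ ¬ HasZeroMean u ∧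
      meanEnergy (fun _ : ℝ => u) ≤ E ∧ ε ≤ meanDissipation ν (fun _ : ℝ => u)}

/-- **Cycle witnesses**: `c` carries, at some `ν ∈ (0,a)`, a time-periodic classical solution that is NOT constant in time, with
budgets `(E, ε)`. [folklore] -/
def loudCycle (S : Finset (Fin 3 → ℤ)) (a E ε : ℝ) : Set (Coeff S) :=
  {c | ∃ ν : ℝ, 0 < ν ∧ ν < a ∧ ∃ (τ : ℝ) (u : ℝ → 𝕋³ → ℝ³) (p : ℝ → 𝕋³ → ℝ), 0 < τ ∧
    IsClassicalNSSolutionOn Set.univ ν (fun _ => force S c) u p ∧ Function.Periodic u τ ∧ (∃ t, u t ≠ u 0) ∧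
      meanEnergy u ≤ E ∧ ε ≤ meanDissipation ν u}

/-- Drift steady witnesses are loud witnesses. [folklore] -/
theorem loudSteadyDrift_subset_loud (S : Finset (Fin 3 → ℤ)) (a E ε : ℝ) : loudSteadyDrift S a E ε ⊆ loud S a E ε := by
  rintro c ⟨ν, hν, hνa, u, p, hst, -, hE, hε⟩
  exact ⟨ν, hν, hνa, 1, fun _ => u, fun _ => p, one_pos, hst, fun _ => rfl, hE, hε⟩

/-- Cycle witnesses are loud witnesses. [folklore] -/
theorem loudCycle_subset_loud (S : Finset (Fin 3 → ℤ)) (a E ε : ℝ) : loudCycle S a E ε ⊆ loud S a E ε := by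
  rintro c ⟨ν, hν, hνa, τ, u, p, hτ, hsol, hper, -, hE, hε⟩
  exact ⟨ν, hν, hνa, τ, u, p, hτ, hsol, hper, hE, hε⟩

/-! ## §2 The loud set splits by witness type -/

/-- **Split by witness type**: a loud witness is constant in time — then `(u 0, p 0)` is a classical steady state with the same
budgets (`isSteadyNSState_of_forall_eq`), of zero mean or not — or a genuine cycle. [folklore] -/
theorem loud_subset_union (S : Finset (Fin 3 → ℤ)) (a E ε : ℝ) :
    loud S a E ε ⊆ loudSteadyLeaf S a E ε ∪ loudSteadyDrift S a E ε ∪ loudCycle S a E ε := by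
  rintro c ⟨ν, hν, hνa, τ, u, p, hτ, hsol, hper, hE, hε⟩
  by_cases hc : ∃ t, u t ≠ u 0
  · exact Or.inr ⟨ν, hν, hνa, τ, u, p, hτ, hsol, hper, hc, hE, hε⟩
  · push Not at hc
    have hu : u = fun _ => u 0 := funext hc
    have hst : Torus.IsSteadyNSState ν (force S c) (u 0) (p 0) := isSteadyNSState_of_forall_eq hsol hc
    have hE' : meanEnergy (fun _ : ℝ => u 0) ≤ E := by rw [← hu]; exact hE
    have hε' : ε ≤ meanDissipation ν (fun _ : ℝ => u 0) := by rw [← hu]; exact hε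
    by_cases h0 : HasZeroMean (u 0)
    · exact Or.inl (Or.inl ⟨ν, hν, hνa, u 0, p 0, hst, h0, hE', hε'⟩)
    · exact Or.inl (Or.inr ⟨ν, hν, hνa, u 0, p 0, hst, h0, hE', hε'⟩)

/-- The split is an identity. [folklore] -/
theorem loud_eq_union (S : Finset (Fin 3 → ℤ)) (a E ε : ℝ) :
    loud S a E ε = loudSteadyLeaf S a E ε ∪ loudSteadyDrift S a E ε ∪ loudCycle S a E ε :=
  (loud_subset_union S a E ε).antisymm
    (union_subset (union_subset (loudSteadyLeaf_subset_loud S a E ε) (loudSteadyDrift_subset_loud S a E ε))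
      (loudCycle_subset_loud S a E ε))

/-! ## §3 The wild residual, decomposed -/

/-- **Decomposition of the wild residual** (`0 < ε`): a loud force outside `closure (interior LOUD₂)` carries either only
mean-zero steady witnesses AND is non-generic (`∉ genericSet S`, a meagre budget-free set), or a drift steady witness, or a genuine
cycle. [folklore] -/
theorem residual_decomposition (S : Finset (Fin 3 → ℤ)) (a E ε : ℝ) (hε : 0 < ε) :
    loud S a E ε \ closure (interior (loud S a (2 * E) (ε / 2))) ⊆
      (loudSteadyLeaf S a E ε ∩ (genericSet S)ᶜ) ∪
        (loudSteadyDrift S a E ε \ closure (interior (loud S a (2 * E) (ε / 2)))) ∪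
          (loudCycle S a E ε \ closure (interior (loud S a (2 * E) (ε / 2)))) := by
  rintro c ⟨hc, hn⟩
  rcases loud_subset_union S a E ε hc with (hl | hd) | hy
  · exact Or.inl (Or.inl ⟨hl, steadyLeaf_residual_subset_compl_genericSet S a E ε hε ⟨hl, hn⟩⟩)
  · exact Or.inl (Or.inr ⟨hd, hn⟩)
  · exact Or.inr ⟨hy, hn⟩

/-- The first piece of the decomposition is MEAGRE (for all budgets at once: it lies in `(genericSet S)ᶜ`). [folklore] -/
theorem isMeagre_loudSteadyLeaf_inter_compl_genericSet (S : Finset (Fin 3 → ℤ)) (a E ε : ℝ) :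
    IsMeagre (loudSteadyLeaf S a E ε ∩ (genericSet S)ᶜ) :=
  (isMeagre_compl_genericSet S).mono inter_subset_right

/-- **Registered sub-goal `residual_decomposition_registered` (lead c15)** — the decomposition with the drift and cycle classes
written out: for every `S`, ceiling `a` and budgets with `0 < ε`, every force of `loud S a E ε ∖ closure (interior (loud S a (2E)
(ε/2)))` either (i) carries a mean-zero classical steady loud witness and lies in the meagre set `(genericSet S)ᶜ`, or (ii) carries a
classical steady loud witness of non-zero mean, or (iii) carries a loud classical time-periodic solution that is not constant in
time. [folklore] -/
theorem residual_decomposition_registered : ∀ (S : Finset (Fin 3 → ℤ)) (a E ε : ℝ), 0 < ε →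
    ∀ c ∈ loud S a E ε \ closure (interior (loud S a (2 * E) (ε / 2))),
      (c ∈ loudSteadyLeaf S a E ε ∧ c ∉ genericSet S) ∨
      (∃ ν : ℝ, 0 < ν ∧ ν < a ∧ ∃ (u : UnitAddTorus (Fin 3) → EuclideanSpace ℝ (Fin 3)) (p : UnitAddTorus (Fin 3) → ℝ),
        Torus.IsSteadyNSState ν (force S c) u p ∧ ¬ HasZeroMean u ∧
          meanEnergy (fun _ : ℝ => u) ≤ E ∧ ε ≤ meanDissipation ν (fun _ : ℝ => u)) ∨
      (∃ ν : ℝ, 0 < ν ∧ ν < a ∧ ∃ (τ : ℝ) (u : ℝ → UnitAddTorus (Fin 3) → EuclideanSpace ℝ (Fin 3))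
        (p : ℝ → UnitAddTorus (Fin 3) → ℝ), 0 < τ ∧
          IsClassicalNSSolutionOn Set.univ ν (fun _ => force S c) u p ∧ Function.Periodic u τ ∧ (∃ t, u t ≠ u 0) ∧
            meanEnergy u ≤ E ∧ ε ≤ meanDissipation ν u) := by
  intro S a E ε hε c hc
  rcases residual_decomposition S a E ε hε hc with (⟨hl, hg⟩ | ⟨hd, -⟩) | ⟨hy, -⟩
  · exact Or.inl ⟨hl, hg⟩
  · exact Or.inr (Or.inl hd)
  · exact Or.inr (Or.inr hy)

end Summit.AnomalousDissipation.AnomalousDissipation.Theorems.RobustLoudUpgrade.Category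

end
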